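import Summits.QuantumAdvantage.QuantumAdvantage.Theorems.WbwObfuscatedGluedTrees.Negative.TypedTraps
import Literature.Computability.Complexity.CodeFPArith

/-!
# `WbwObfuscatedGluedTrees` (stmt-QuantumAdvantage-2340) — VIII: load-bearing clauses of `Coherent` in the split lemma

Negative / support lemmas for line `knowledge-of-walk-split` of the INFORMAL crux `WbwObfuscatedGluedTrees`
(`Cruxes/WbwObfuscatedGluedTrees/Lines/knowledge-of-walk-split.lean`, stub `stub_split`), filed by the deep-refute
seat refuter-drefute-stmt-QuantumAdvantage-2340-0.  Sorry-free; no Theses decl is asserted (the statements refuted are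
WEAKENINGS of the registered stub `stub_split`, i.e. "any proof of `stub_split` must use this clause").  §0 copies
the line's vocabulary verbatim (`ClauseC`, `WalkModel`, `inst`, `KnowledgeOfWalk`, `WordHard`, `Coherent`,
`SplitLemma`; the Lines file is not importable); once the lead lands the vocabulary file these copies can be replaced
by an import without touching the theorems.

* `not_clauseC_self` — clause (C) never holds for `ans = gen` (the echo adversary `RandAlg.ofDet Brick.sndF`).
* `splitLemma_false_without_length` — drop ONLY the length clause `|ans s| = nameLen (gen s)` of `Coherent`: FALSE
  (model `M₁`: `nameLen := 0`, the only valid name of instance `x` is `x` itself, entrance `false :: x`; KWA and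
  WordHard hold vacuously, (C) fails for `gen = ans = id`).
* `splitLemma_false_without_valid` — drop ONLY the validity clause: FALSE (model `M₂`: nothing is valid).
The third clause `ans s ≠ entrance (gen s)` is NOT load-bearing (derivable on average from `WordHard` via the empty
word; see the seat's note `NegativeNotes-stub_split.md`) — not formalised here.
-/

set_option linter.dupNamespace false

namespace Summit.QuantumAdvantage.QuantumAdvantage.Theorems.WbwObfuscatedGluedTrees.Negative

open Literature.Computability.Cryptography Literature.Computability.Complexity
open Filter Asymptotics _root_.Computability

namespace SplitMutation

/-! ## §0 Vocabulary of the line (verbatim copies of `Lines/knowledge-of-walk-split.lean` §0–§3) -/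

/-- Clause (C) of `WbwThesis` for a fixed pair `(gen, ans)` (verbatim). -/
def ClauseC (gen ans : List Bool → List Bool) : Prop :=
  ∀ A : RandAlg (List Bool) (List Bool), IsPPT A id →
    SuperpolynomialDecay atTop (fun n : ℕ => (n : ℝ)) (fun n : ℕ =>
      uniformAvg n fun s => A.pr id (boolPair (Computability.unaryEncodeNat n) (gen s)) {y | ans s <+: y})

/-- Walk semantics of instance strings (verbatim). -/
structure WalkModel where
  /-- name of the ENTRANCE carried by the instance -/
  entrance : List Bool → List Bool
  /-- the common length of vertex names of the instance -/
  nameLen : List Bool → ℕ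
  /-- neighbour listing of the instance on a name (`none` on invalid names) -/
  nbrs : List Bool → List Bool → Option (List (List Bool))

namespace WalkModel

/-- Execute a walk-word from the ENTRANCE (verbatim). -/
def endpoint (M : WalkModel) (x : List Bool) : List ℕ → Option (List Bool)
  | [] => some (M.entrance x)
  | i :: w => (endpoint M x w).bind fun cur => (M.nbrs x cur).bind fun l => l[i]?

/-- Validity of a name (verbatim). -/
def IsValid (M : WalkModel) (x y : List Bool) : Prop := (M.nbrs x y).isSome = true

/-- The name part of an output string (verbatim). -/
def nameOf (M : WalkModel) (x y : List Bool) : List Bool := y.take (M.nameLen x)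

end WalkModel

/-- The adversary's input `⟨1ⁿ, gen s⟩` (verbatim). -/
def inst (gen : List Bool → List Bool) (n : ℕ) (s : List Bool) : List Bool :=
  boolPair (Computability.unaryEncodeNat n) (gen s)

/-- KWA (verbatim). -/
def KnowledgeOfWalk (M : WalkModel) (gen : List Bool → List Bool) : Prop :=
  ∀ A : RandAlg (List Bool) (List Bool), IsPPT A id →
    ∃ E : List Bool → List ℕ, PolyTimeComputable id encodingListNatBool.encode E ∧
      SuperpolynomialDecay atTop (fun n : ℕ => (n : ℝ)) (fun n : ℕ =>
        uniformAvg n fun s => uniformProb (A.coinLen (inst gen n s).length)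
          {r | M.IsValid (gen s) (M.nameOf (gen s) (A.run (inst gen n s) r)) ∧
               M.nameOf (gen s) (A.run (inst gen n s) r) ≠ M.entrance (gen s) ∧
               M.endpoint (gen s) (E (boolPair (inst gen n s) r)) ≠
                 some (M.nameOf (gen s) (A.run (inst gen n s) r))})

/-- WordHard (verbatim). -/
def WordHard (M : WalkModel) (gen ans : List Bool → List Bool) : Prop :=
  ∀ W : RandAlg (List Bool) (List ℕ), IsPPT W encodingListNatBool.encode →
    SuperpolynomialDecay atTop (fun n : ℕ => (n : ℝ)) (fun n : ℕ =>
      uniformAvg n fun s => W.pr id (inst gen n s) {w | M.endpoint (gen s) w = some (ans s)})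

/-- Coherent (verbatim). -/
def Coherent (M : WalkModel) (gen ans : List Bool → List Bool) : Prop :=
  ∀ s, (ans s).length = M.nameLen (gen s) ∧ M.IsValid (gen s) (ans s) ∧ ans s ≠ M.entrance (gen s)

/-- The registered stub's statement (verbatim). -/
def SplitLemma : Prop :=
  ∀ (M : WalkModel) (gen ans : List Bool → List Bool),
    Coherent M gen ans → KnowledgeOfWalk M gen → WordHard M gen ans → ClauseC gen ans

/-! ## §1 The two weakenings -/

/-- `SplitLemma` with the LENGTH clause of `Coherent` dropped. -/
def SplitLemmaWithoutLength : Prop :=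
  ∀ (M : WalkModel) (gen ans : List Bool → List Bool),
    (∀ s, M.IsValid (gen s) (ans s) ∧ ans s ≠ M.entrance (gen s)) →
    KnowledgeOfWalk M gen → WordHard M gen ans → ClauseC gen ans

/-- `SplitLemma` with the VALIDITY clause of `Coherent` dropped. -/
def SplitLemmaWithoutValid : Prop :=
  ∀ (M : WalkModel) (gen ans : List Bool → List Bool),
    (∀ s, (ans s).length = M.nameLen (gen s) ∧ ans s ≠ M.entrance (gen s)) →
    KnowledgeOfWalk M gen → WordHard M gen ans → ClauseC gen ans

/-- The weakenings are indeed stronger statements than the stub. [folklore] -/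
theorem splitLemma_of_withoutLength (h : SplitLemmaWithoutLength) : SplitLemma :=
  fun M gen ans hc => h M gen ans fun s => (hc s).2

/-- The weakenings are indeed stronger statements than the stub. [folklore] -/
theorem splitLemma_of_withoutValid (h : SplitLemmaWithoutValid) : SplitLemma :=
  fun M gen ans hc => h M gen ans fun s => ⟨(hc s).1, (hc s).2.2⟩

/-! ## §2 Generic tools -/

/-- The probability of an event no coin string reaches is `0`. [folklore] -/
theorem pr_eq_zero_of_forall_not_mem {α β : Type} (A : RandAlg α β) (ea : α → List Bool) (x : α)
    (E : Set β) (h : ∀ r, A.run x r ∉ E) : A.pr ea x E = 0 := by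
  unfold RandAlg.pr RandAlg.outputPMF
  rw [PMF.toOuterMeasure_map_apply]
  have hempty : (fun r : List.Vector Bool (A.coinLen (ea x).length) => A.run x r.toList) ⁻¹' E = ∅ :=
    Set.eq_empty_iff_forall_notMem.2 fun r hr => h _ hr
  rw [hempty]
  simp

/-- `uniformProb` of an event containing no string is `0`. [folklore] -/
theorem uniformProb_eq_zero_of_forall_not_mem {m : ℕ} {E : Set (List Bool)} (h : ∀ r, r ∉ E) :
    uniformProb m E = 0 := by
  have : E = ∅ := Set.eq_empty_iff_forall_notMem.2 h
  rw [this, uniformProb_empty]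

/-- A uniform average of a function vanishing on the sampled length is `0`. [folklore] -/
theorem uniformAvg_eq_zero_of_forall {n : ℕ} {g : List Bool → ℝ} (h : ∀ s : List Bool, s.length = n → g s = 0) :
    uniformAvg n g = 0 := by
  unfold uniformAvg
  rw [Finset.sum_eq_zero fun (x : List.Vector Bool n) _ => h x.toList (by simp), zero_div]

/-- A sequence vanishing from some index on decays superpolynomially. [folklore] -/
theorem superpolynomialDecay_of_eventually_eq_zero {f : ℕ → ℝ} (h : ∀ᶠ n in atTop, f n = 0) :
    SuperpolynomialDecay atTop (fun n : ℕ => (n : ℝ)) f :=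
  (superpolynomialDecay_zero atTop fun n : ℕ => (n : ℝ)).congr' (h.mono fun _ hn => hn.symm)

/-- **The echo adversary breaks clause (C) whenever the answer IS the instance payload**: for every `gen`,
`ClauseC gen gen` is false (`RandAlg.ofDet Brick.sndF` reads `gen s` off `⟨1ⁿ, gen s⟩`). [folklore] -/
theorem not_clauseC_self (gen : List Bool → List Bool) : ¬ ClauseC gen gen := by
  classical
  intro hC
  have hPPT : IsPPT (RandAlg.ofDet Brick.sndF) id := RandAlg.IsPolyTime.ofDet_holds Brick.sndF_mem_FP
  refine not_superpolynomialDecay_of_frequently_le one_pos (Eventually.of_forall fun n => ?_).frequently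
    (hC _ hPPT)
  have hpr : ∀ s : List Bool,
      (RandAlg.ofDet Brick.sndF).pr id (boolPair (unaryEncodeNat n) (gen s)) {y | gen s <+: y} = 1 := by
    intro s
    rw [RandAlg.pr_ofDet, if_pos]
    simp
  simp only [uniformAvg, hpr]
  simp [card_vector]

/-! ## §3 Model `M₁`: the length clause is load-bearing -/

/-- `M₁`: names have length `0`, the only valid name of instance `x` is `x`, the entrance `false :: x` is invalid. -/
def M₁ : WalkModel where
  entrance x := false :: x
  nameLen _ := 0
  nbrs x y := if y = x then some [] else none

/-- In `M₁` the valid names of instance `x` are exactly `x`. [folklore] -/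
theorem M₁_isValid_iff (x y : List Bool) : M₁.IsValid x y ↔ y = x := by
  unfold WalkModel.IsValid M₁
  by_cases h : y = x <;> simp [h]

/-- In `M₁` every name part is empty (`nameLen = 0`). [folklore] -/
theorem M₁_nameOf (x y : List Bool) : M₁.nameOf x y = [] := by
  simp [WalkModel.nameOf, M₁]

/-- In `M₁` every non-empty walk-word leaves the valid names (the entrance is invalid). [folklore] -/
theorem M₁_endpoint_cons (x : List Bool) (i : ℕ) (w : List ℕ) : M₁.endpoint x (i :: w) = none := by
  simp only [WalkModel.endpoint]
  cases M₁.endpoint x w with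
  | none => rfl
  | some cur =>
    simp only [Option.bind_some, M₁]
    by_cases h : cur = x <;> simp [h]

/-- In `M₁` no walk-word ends at the instance's own name `x`. [folklore] -/
theorem M₁_endpoint_ne (x : List Bool) (w : List ℕ) : M₁.endpoint x w ≠ some x := by
  cases w with
  | nil =>
    simp only [WalkModel.endpoint, M₁, ne_eq, Option.some.injEq]
    exact List.cons_ne_self false x
  | cons i w => rw [M₁_endpoint_cons]; simp

/-- KWA holds in `M₁` for `gen = id`, vacuously from length `1` on (the failure event asks `[]` to be valid). [folklore] -/
theorem M₁_knowledgeOfWalk : KnowledgeOfWalk M₁ id := by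
  intro A _
  refine ⟨fun _ => [], PolyTimeComputable.const _ _ ([] : List ℕ), ?_⟩
  refine superpolynomialDecay_of_eventually_eq_zero ?_
  filter_upwards [eventually_ge_atTop 1] with n hn
  refine uniformAvg_eq_zero_of_forall fun s hs => uniformProb_eq_zero_of_forall_not_mem fun r hr => ?_
  obtain ⟨hv, -, -⟩ := hr
  rw [M₁_nameOf, M₁_isValid_iff] at hv
  have hs0 : s = [] := hv.symm
  subst hs0
  simp only [List.length_nil] at hs
  omega

/-- WordHard holds in `M₁` for `gen = ans = id`, vacuously (no word ends at `x`). [folklore] -/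
theorem M₁_wordHard : WordHard M₁ id id := by
  intro W _
  refine superpolynomialDecay_of_eventually_eq_zero (Eventually.of_forall fun n => ?_)
  exact uniformAvg_eq_zero_of_forall fun s _ =>
    pr_eq_zero_of_forall_not_mem W id _ _ fun r hr => M₁_endpoint_ne s _ hr

/-- **Any proof of `stub_split` must use the length clause of `Coherent`.** [folklore] -/
theorem splitLemma_false_without_length : ¬ SplitLemmaWithoutLength := by
  intro h
  refine not_clauseC_self id (h M₁ id id (fun s => ⟨?_, ?_⟩) M₁_knowledgeOfWalk M₁_wordHard)
  · exact (M₁_isValid_iff s s).2 rfl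
  · exact (List.cons_ne_self false s).symm

/-! ## §4 Model `M₂`: the validity clause is load-bearing -/

/-- `M₂`: names of instance `x` have length `|x|`, NOTHING is valid, entrance `false :: x`. -/
def M₂ : WalkModel where
  entrance x := false :: x
  nameLen x := x.length
  nbrs _ _ := none

/-- In `M₂` nothing is valid. [folklore] -/
theorem M₂_not_isValid (x y : List Bool) : ¬ M₂.IsValid x y := by
  simp [WalkModel.IsValid, M₂]

/-- In `M₂` every non-empty walk-word leaves the valid names. [folklore] -/
theorem M₂_endpoint_cons (x : List Bool) (i : ℕ) (w : List ℕ) : M₂.endpoint x (i :: w) = none := by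
  simp only [WalkModel.endpoint]
  cases M₂.endpoint x w with
  | none => rfl
  | some cur => simp [M₂]

/-- In `M₂` no walk-word ends at the instance's own name `x`. [folklore] -/
theorem M₂_endpoint_ne (x : List Bool) (w : List ℕ) : M₂.endpoint x w ≠ some x := by
  cases w with
  | nil =>
    simp only [WalkModel.endpoint, M₂, ne_eq, Option.some.injEq]
    exact List.cons_ne_self false x
  | cons i w => rw [M₂_endpoint_cons]; simp

/-- KWA holds in `M₂` for every `gen`, vacuously (the failure event asks a valid name). [folklore] -/
theorem M₂_knowledgeOfWalk (gen : List Bool → List Bool) : KnowledgeOfWalk M₂ gen := by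
  intro A _
  refine ⟨fun _ => [], PolyTimeComputable.const _ _ ([] : List ℕ), ?_⟩
  refine superpolynomialDecay_of_eventually_eq_zero (Eventually.of_forall fun n => ?_)
  exact uniformAvg_eq_zero_of_forall fun s _ =>
    uniformProb_eq_zero_of_forall_not_mem fun r hr => M₂_not_isValid _ _ hr.1

/-- WordHard holds in `M₂` for `gen = ans = id`, vacuously. [folklore] -/
theorem M₂_wordHard : WordHard M₂ id id := by
  intro W _
  refine superpolynomialDecay_of_eventually_eq_zero (Eventually.of_forall fun n => ?_)
  exact uniformAvg_eq_zero_of_forall fun s _ =>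
    pr_eq_zero_of_forall_not_mem W id _ _ fun r hr => M₂_endpoint_ne s _ hr

/-- **Any proof of `stub_split` must use the validity clause of `Coherent`.** [folklore] -/
theorem splitLemma_false_without_valid : ¬ SplitLemmaWithoutValid := by
  intro h
  refine not_clauseC_self id (h M₂ id id (fun s => ⟨rfl, ?_⟩) (M₂_knowledgeOfWalk id) M₂_wordHard)
  exact (List.cons_ne_self false s).symm

end SplitMutation

end Summit.QuantumAdvantage.QuantumAdvantage.Theorems.WbwObfuscatedGluedTrees.Negative
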